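import Summits.Ventures.DiscreteObjects.PP12.OrderElevenCollineation

/-!
# PP(12), order-11 cell, Case B (`NoTriangleData12`): the SYMMETRIES of valid triangle data (designs g23)
Framing: lottery ticket; floor = certified bounds/negative ranges.

Cell pub-namedobj (venture DiscreteObjects), target (M). The Case-B normal form `TriangleData 11` / `Valid` (`OrderElevenCollineation`, FAMILY-B1P §3)
still carries base choices; re-choosing them gives validity-preserving maps, which the kernel certificate uses to reduce the third-pencil map `φ` to
11 orbit representatives (`OrderElevenTriangleKernel`, generators `actT, actM, actI, actS` on packed maps):

* `normalize` — re-base the third pencil: `φ ↦ φ − φ 0` (`g₂ ↦ g₂ + φ 0`); afterwards `φ 0 = 0`;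
* `relabel` (generator `T`) — rename the free point orbits `t ↦ t + 1` (re-base the first pencil, then re-normalise): `φ' t = φ (t − 1) − φ 10`;
* `scale` (generator `M`) — replace `σ` by a power, i.e. multiply every exponent by `2`: `φ' t = 2 φ (6 t)`;
* `swap12` (generator `I`) — exchange the roles of the pencils `1` and `2`: `φ' = φ⁻¹`, `g₁ ↔ g₂`;
* `swap01` (generator `S`) — exchange the roles of the pencils `0` and `1`: `φ' t = φ (−t) + t`, blocks translated by `−t − g₁`, `g₁' = −g₁`, `g₂' = g₂ − g₁`.

Main results: `Valid` is preserved by each map (`normalize_valid`, `relabel_valid`, `scale_valid`, `swap12_valid`, `swap01_valid`) and `φ 0 = 0` is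
preserved by the four generators (`*_phi_zero`). The proofs transfer the uniqueness statements of `Valid` along bijections of `Z₁₁`
(`partitionOK_transfer`, `internalOK_transfer`, `pairNone_transfer`, `pairOne_transfer`). Nothing here asserts a census statement. No `sorry`, no new axioms.
-/

namespace Summit.Ventures.DiscreteObjects.PP12

namespace TriangleData

open Function
open Fin.CommRing -- `Fin 11` as a commutative ring (scoped Mathlib instance): cyclic residue arithmetic

/-! ### transfer of the uniqueness statements along bijections -/

/-- `∃! t, P t` (spelled out) transfers along a bijection `t = e u` -/
theorem exu_transfer {α : Type*} (e : α ≃ α) {P Q : α → Prop} (hPQ : ∀ u, Q u ↔ P (e u)) :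
    (∃ t, P t ∧ ∀ t', P t' → t' = t) → ∃ u, Q u ∧ ∀ u', Q u' → u' = u := by
  rintro ⟨t, ht, hu⟩
  refine ⟨e.symm t, by simpa [hPQ] using ht, fun u' hu' => ?_⟩
  rw [Equiv.eq_symm_apply]; exact hu _ ((hPQ u').1 hu')

/-- the two-variable uniqueness statement (shape of `InternalOK` / `PairOne`) transfers along `t = e u`, `x = f u z` -/
theorem exu2_transfer {α β : Type*} (e : α ≃ α) (f : α → β ≃ β) {A B A' B' : α → β → Prop}
    (hA : ∀ u z, A' u z ↔ A (e u) (f u z)) (hB : ∀ u z, B' u z ↔ B (e u) (f u z)) :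
    (∃ t x, A t x ∧ B t x ∧ ∀ t' x', A t' x' → B t' x' → t' = t ∧ x' = x) →
      ∃ u z, A' u z ∧ B' u z ∧ ∀ u' z', A' u' z' → B' u' z' → u' = u ∧ z' = z := by
  rintro ⟨t, x, ha, hb, hu⟩
  refine ⟨e.symm t, (f (e.symm t)).symm x, by simpa [hA] using ha, by simpa [hB] using hb, fun u' z' ha' hb' => ?_⟩
  obtain ⟨h1, h2⟩ := hu _ _ ((hA u' z').1 ha') ((hB u' z').1 hb')
  have hu' : u' = e.symm t := by rw [Equiv.eq_symm_apply]; exact h1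
  subst hu'
  exact ⟨rfl, by rw [Equiv.eq_symm_apply]; exact h2⟩

variable {D D' : TriangleData 11} {s s' : Fin 11}

/-- `PartitionOK` transfers along labels `t = e u` and an injective residue map `β` when
`D'.mem s u (y + f' u) = D.mem s (e u) (β y + f (e u))` and `β g' = g` -/
theorem partitionOK_transfer {f f' : Fin 11 → Fin 11} {g g' : Fin 11} (e : Fin 11 ≃ Fin 11) (β : Fin 11 → Fin 11)
    (hβ : Injective β) (hg : β g' = g) (hmem : ∀ u y, D'.mem s u (y + f' u) = D.mem s (e u) (β y + f (e u))) :
    D.PartitionOK s f g → D'.PartitionOK s f' g' := by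
  rintro ⟨h1, h2⟩
  refine ⟨fun u => by rw [hmem, hg]; exact h1 (e u), fun y hy => ?_⟩
  have hy' : β y ≠ g := fun h => hy (hβ (h.trans hg.symm))
  exact exu_transfer e (fun u => by rw [hmem]) (h2 (β y) hy')

/-- `InternalOK` transfers along `t = e u`, `x = β u z` when `β u (z − δ) = β u z − γ δ` and `γ` preserves `≠ 0` -/
theorem internalOK_transfer (e : Fin 11 ≃ Fin 11) (β : Fin 11 → Fin 11 ≃ Fin 11) (γ : Fin 11 → Fin 11)
    (hγ : ∀ δ, δ ≠ 0 → γ δ ≠ 0) (hmem : ∀ u x, D'.mem s u x = D.mem s (e u) (β u x))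
    (hβ : ∀ u z δ, β u (z - δ) = β u z - γ δ) : D.InternalOK s → D'.InternalOK s := fun h δ hδ =>
  exu2_transfer e β (A := fun t x => D.mem s t x = true) (B := fun t x => D.mem s t (x - γ δ) = true)
    (A' := fun u z => D'.mem s u z = true) (B' := fun u z => D'.mem s u (z - δ) = true)
    (fun u z => by simp only [hmem]) (fun u z => by simp only [hmem, hβ]) (h (γ δ) (hγ δ hδ))

/-- `PairNone` transfers -/
theorem pairNone_transfer (e : Fin 11 ≃ Fin 11) (β : Fin 11 → Fin 11 ≃ Fin 11) {δ δ' : Fin 11}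
    (hs : ∀ u x, D'.mem s u x = D.mem s (e u) (β u x)) (hs' : ∀ u x, D'.mem s' u (x - δ) = D.mem s' (e u) (β u x - δ')) :
    D.PairNone s s' δ' → D'.PairNone s s' δ := fun h u x hx =>
  h (e u) (β u x) (by rw [← hs, ← hs']; exact hx)

/-- `PairOne` transfers -/
theorem pairOne_transfer (e : Fin 11 ≃ Fin 11) (β : Fin 11 → Fin 11 ≃ Fin 11) {δ δ' : Fin 11}
    (hs : ∀ u x, D'.mem s u x = D.mem s (e u) (β u x)) (hs' : ∀ u x, D'.mem s' u (x - δ) = D.mem s' (e u) (β u x - δ')) :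
    D.PairOne s s' δ' → D'.PairOne s s' δ :=
  exu2_transfer e β (A := fun t x => D.mem s t x = true) (B := fun t x => D.mem s' t (x - δ') = true)
    (A' := fun u z => D'.mem s u z = true) (B' := fun u z => D'.mem s' u (z - δ) = true)
    (fun u z => by simp only [hs]) (fun u z => by simp only [hs'])

/-- the residue translation `z ↦ z + c` as a bijection -/
def addEquiv11 (c : Fin 11) : Fin 11 ≃ Fin 11 := ⟨fun z => z + c, fun z => z - c, fun z => by simp, fun z => by simp⟩

/-- `addEquiv11 c z = z + c` -/
@[simp] theorem addEquiv11_apply (c z : Fin 11) : addEquiv11 c z = z + c := rfl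

variable (D : TriangleData 11)

/-! ### `normalize`: `φ ↦ φ − φ 0` -/

/-- re-base the third pencil so that `φ 0 = 0` -/
def normalize : TriangleData 11 where
  phi t := D.phi t - D.phi 0
  g1 := D.g1
  g2 s := D.g2 s + D.phi 0
  mem := D.mem

/-- `normalize` achieves `φ 0 = 0` -/
theorem normalize_phi_zero : D.normalize.phi 0 = 0 := sub_self _

/-- the new `φ` -/
theorem normalize_phi (t : Fin 11) : D.normalize.phi t = D.phi t - D.phi 0 := rfl

/-- `normalize` preserves validity -/
theorem normalize_valid (h : D.Valid) : D.normalize.Valid := by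
  obtain ⟨⟨hp1, hp2⟩, hK, hX⟩ := h
  refine ⟨⟨fun t t' e => hp1 t t' ?_, fun t t' e => hp2 t t' ?_⟩, fun s => ?_, fun s s' hss' => ?_⟩
  · have e' : D.phi t - D.phi 0 = D.phi t' - D.phi 0 := e
    exact sub_left_injective e'
  · have e' : t - (D.phi t - D.phi 0) = t' - (D.phi t' - D.phi 0) := e
    have key : ∀ u : Fin 11, u - D.phi u = u - (D.phi u - D.phi 0) - D.phi 0 := fun u => by ring
    rw [key t, key t', e']
  · obtain ⟨h0, h1, h2, hD⟩ := hK s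
    refine ⟨h0, h1, ?_, hD⟩
    refine partitionOK_transfer (Equiv.refl _) (fun y => y - D.phi 0) sub_left_injective (by simp [normalize]) ?_ h2
    intro u y
    show D.mem s u (y + (D.phi u - D.phi 0)) = D.mem s u (y - D.phi 0 + D.phi u)
    congr 1; ring
  · obtain ⟨hg1, hg2, hp0, hδ⟩ := hX s s' hss'
    have e2 : D.normalize.g2 s - D.normalize.g2 s' = D.g2 s - D.g2 s' :=
      show D.g2 s + D.phi 0 - (D.g2 s' + D.phi 0) = D.g2 s - D.g2 s' by ring
    refine ⟨hg1, fun e => hg2 (add_right_cancel (e : D.g2 s + D.phi 0 = D.g2 s' + D.phi 0)), hp0, fun δ hδ0 => ?_⟩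
    rw [e2]; exact hδ δ hδ0

/-! ### `relabel` (generator `T`): rename the point orbits `t ↦ t + 1` -/

/-- rename the free point orbits by `t ↦ t + 1`, re-base the first pencil and re-normalise the third -/
def relabel : TriangleData 11 where
  phi t := D.phi (t - 1) - D.phi 10
  g1 s := D.g1 s - 1
  g2 s := D.g2 s + D.phi 10
  mem s t x := D.mem s (t - 1) x

/-- the new `φ` -/
theorem relabel_phi (t : Fin 11) : D.relabel.phi t = D.phi (t - 1) - D.phi 10 := rfl

/-- `relabel` keeps `φ 0 = 0` (indeed makes it so) -/
theorem relabel_phi_zero : D.relabel.phi 0 = 0 := by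
  show D.phi (0 - 1) - D.phi 10 = 0
  have : (0 - 1 : Fin 11) = 10 := by decide
  rw [this, sub_self]

/-- `relabel` preserves validity -/
theorem relabel_valid (h : D.Valid) : D.relabel.Valid := by
  obtain ⟨⟨hp1, hp2⟩, hK, hX⟩ := h
  have hm : ∀ s u x, D.relabel.mem s u x = D.mem s (addEquiv11 (-1) u) x := fun s u x => by
    simp only [addEquiv11_apply]; rw [← sub_eq_add_neg]; rfl
  refine ⟨⟨fun t t' e => ?_, fun t t' e => ?_⟩, fun s => ?_, fun s s' hss' => ?_⟩
  · have e' : D.phi (t - 1) - D.phi 10 = D.phi (t' - 1) - D.phi 10 := e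
    exact sub_left_injective (hp1 _ _ (sub_left_injective e'))
  · have e' : t - (D.phi (t - 1) - D.phi 10) = t' - (D.phi (t' - 1) - D.phi 10) := e
    have key : ∀ u : Fin 11, u - 1 - D.phi (u - 1) = u - (D.phi (u - 1) - D.phi 10) - D.phi 10 - 1 := fun u => by ring
    have := hp2 (t - 1) (t' - 1) (by rw [key t, key t', e'])
    exact sub_left_injective this
  · obtain ⟨h0, h1, h2, hD⟩ := hK s
    refine ⟨?_, ?_, ?_, ?_⟩
    · exact partitionOK_transfer (addEquiv11 (-1)) id injective_id rfl (fun u y => by rw [hm]; rfl) h0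
    · refine partitionOK_transfer (addEquiv11 (-1)) (fun y => y + 1) (add_left_injective 1) ?_ (fun u y => ?_) h1
      · show D.g1 s - 1 + 1 = D.g1 s; ring
      · rw [hm]; simp only [id, addEquiv11_apply]; congr 1; ring
    · refine partitionOK_transfer (addEquiv11 (-1)) (fun y => y - D.phi 10) sub_left_injective ?_ (fun u y => ?_) h2
      · show D.g2 s + D.phi 10 - D.phi 10 = D.g2 s; ring
      · rw [hm]; simp only [addEquiv11_apply]
        show D.mem s (u + -1) (y + (D.phi (u - 1) - D.phi 10)) = D.mem s (u + -1) (y - D.phi 10 + D.phi (u + -1))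
        rw [← sub_eq_add_neg]; congr 1; ring
    · exact internalOK_transfer (addEquiv11 (-1)) (fun _ => Equiv.refl _) id (fun δ hδ => hδ) (fun u x => hm s u x)
        (fun u z δ => rfl) hD
  · obtain ⟨hg1, hg2, hp0, hδ⟩ := hX s s' hss'
    have e1 : D.relabel.g1 s - D.relabel.g1 s' = D.g1 s - D.g1 s' := show D.g1 s - 1 - (D.g1 s' - 1) = _ by ring
    have e2 : D.relabel.g2 s - D.relabel.g2 s' = D.g2 s - D.g2 s' := show D.g2 s + D.phi 10 - (D.g2 s' + D.phi 10) = _ by ring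
    have hPN : ∀ δ, D.PairNone s s' δ → D.relabel.PairNone s s' δ := fun δ =>
      pairNone_transfer (addEquiv11 (-1)) (fun _ => Equiv.refl _) (fun u x => hm s u x) (fun u x => hm s' u _)
    have hPO : ∀ δ, D.PairOne s s' δ → D.relabel.PairOne s s' δ := fun δ =>
      pairOne_transfer (addEquiv11 (-1)) (fun _ => Equiv.refl _) (fun u x => hm s u x) (fun u x => hm s' u _)
    refine ⟨fun e => hg1 (sub_left_injective (e : D.g1 s - 1 = D.g1 s' - 1)),
      fun e => hg2 (add_right_cancel (e : D.g2 s + D.phi 10 = D.g2 s' + D.phi 10)), hPN 0 hp0, fun δ hδ0 => ?_⟩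
    rw [e1, e2]
    rcases hδ δ hδ0 with ⟨a, b, c⟩ | ⟨a, b, c⟩ | ⟨a, b, c⟩
    · exact Or.inl ⟨a, b, hPN δ c⟩
    · exact Or.inr (Or.inl ⟨a, b, hPN δ c⟩)
    · exact Or.inr (Or.inr ⟨a, b, hPO δ c⟩)

/-! ### `scale` (generator `M`): multiply all exponents by `2` -/

/-- arithmetic of `Z₁₁`: `6 · 2 = 1` -/
theorem six_mul_two_mul (x : Fin 11) : 6 * (2 * x) = x := by revert x; decide

/-- arithmetic of `Z₁₁`: `2 · 6 = 1` -/
theorem two_mul_six_mul (x : Fin 11) : 2 * (6 * x) = x := by revert x; decide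

/-- `2 a = δ ↔ a = 6 δ` in `Z₁₁` -/
theorem two_mul_eq_iff (a δ : Fin 11) : 2 * a = δ ↔ a = 6 * δ := by revert a δ; decide

/-- multiplication by `6` as a bijection of `Z₁₁` (inverse: multiplication by `2`) -/
def mul6 : Fin 11 ≃ Fin 11 := ⟨fun u => 6 * u, fun u => 2 * u, two_mul_six_mul, six_mul_two_mul⟩

/-- `mul6 u = 6 u` -/
@[simp] theorem mul6_apply (u : Fin 11) : mul6 u = 6 * u := rfl

/-- replace `σ` by `σ⁶` (all exponents and orbit names multiplied by `2`) -/
def scale : TriangleData 11 where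
  phi t := 2 * D.phi (6 * t)
  g1 s := 2 * D.g1 s
  g2 s := 2 * D.g2 s
  mem s t x := D.mem s (6 * t) (6 * x)

/-- the new `φ` -/
theorem scale_phi (t : Fin 11) : D.scale.phi t = 2 * D.phi (6 * t) := rfl

/-- `scale` keeps `φ 0 = 0` -/
theorem scale_phi_zero (h0 : D.phi 0 = 0) : D.scale.phi 0 = 0 := by
  show 2 * D.phi (6 * 0) = 0; rw [mul_zero, h0, mul_zero]

/-- `scale` preserves validity -/
theorem scale_valid (h : D.Valid) : D.scale.Valid := by
  obtain ⟨⟨hp1, hp2⟩, hK, hX⟩ := h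
  have hm : ∀ s u x, D.scale.mem s u x = D.mem s (mul6 u) (mul6 x) := fun s u x => rfl
  have inj2 : Injective (fun x : Fin 11 => 2 * x) := by intro a b; revert a b; decide
  have inj6 : Injective (fun x : Fin 11 => 6 * x) := mul6.injective
  refine ⟨⟨fun t t' e => ?_, fun t t' e => ?_⟩, fun s => ?_, fun s s' hss' => ?_⟩
  · exact inj6 (hp1 _ _ (inj2 (e : 2 * D.phi (6 * t) = 2 * D.phi (6 * t'))))
  · have e' : t - 2 * D.phi (6 * t) = t' - 2 * D.phi (6 * t') := e
    have key : ∀ u : Fin 11, u - 2 * D.phi (6 * u) = 2 * (6 * u - D.phi (6 * u)) := fun u => by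
      rw [mul_sub, two_mul_six_mul]
    rw [key, key] at e'
    exact inj6 (hp2 _ _ (inj2 e'))
  · obtain ⟨h0, h1, h2, hD⟩ := hK s
    refine ⟨?_, ?_, ?_, ?_⟩
    · exact partitionOK_transfer mul6 (fun y => 6 * y) inj6 (mul_zero _) (fun u y => by rw [hm]; simp) h0
    · refine partitionOK_transfer mul6 (fun y => 6 * y) inj6 (six_mul_two_mul _) (fun u y => ?_) h1
      rw [hm]; simp only [mul6_apply, id, mul_add]
    · refine partitionOK_transfer mul6 (fun y => 6 * y) inj6 (six_mul_two_mul _) (fun u y => ?_) h2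
      rw [hm]; simp only [mul6_apply]
      show D.mem s (6 * u) (6 * (y + 2 * D.phi (6 * u))) = _
      rw [mul_add, six_mul_two_mul]
    · exact internalOK_transfer mul6 (fun _ => mul6) (fun δ => 6 * δ)
        (fun δ hδ h6 => hδ (inj6 ((h6 : 6 * δ = 0).trans (mul_zero _).symm))) (hm s)
        (fun u z δ => show 6 * (z - δ) = 6 * z - 6 * δ from mul_sub _ _ _) hD
  · obtain ⟨hg1, hg2, hp0, hδ⟩ := hX s s' hss'
    have e1 : D.scale.g1 s - D.scale.g1 s' = 2 * (D.g1 s - D.g1 s') := show 2 * D.g1 s - 2 * D.g1 s' = _ by rw [mul_sub]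
    have e2 : D.scale.g2 s - D.scale.g2 s' = 2 * (D.g2 s - D.g2 s') := show 2 * D.g2 s - 2 * D.g2 s' = _ by rw [mul_sub]
    have hPN : ∀ δ, D.PairNone s s' (6 * δ) → D.scale.PairNone s s' δ := fun δ =>
      pairNone_transfer mul6 (fun _ => mul6) (hm s) (fun u x => by rw [hm]; simp only [mul6_apply, mul_sub])
    have hPO : ∀ δ, D.PairOne s s' (6 * δ) → D.scale.PairOne s s' δ := fun δ =>
      pairOne_transfer mul6 (fun _ => mul6) (hm s) (fun u x => by rw [hm]; simp only [mul6_apply, mul_sub])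
    refine ⟨fun e => hg1 (inj2 (e : 2 * D.g1 s = 2 * D.g1 s')), fun e => hg2 (inj2 (e : 2 * D.g2 s = 2 * D.g2 s')),
      hPN 0 (by rw [mul_zero]; exact hp0), fun δ hδ0 => ?_⟩
    simp only [ne_eq, e1, e2, two_mul_eq_iff]
    have h6 : 6 * δ ≠ 0 := fun e => hδ0 (inj6 ((e : 6 * δ = 0).trans (mul_zero _).symm))
    rcases hδ (6 * δ) h6 with ⟨a, b, c⟩ | ⟨a, b, c⟩ | ⟨a, b, c⟩
    · exact Or.inl ⟨a, b, hPN δ c⟩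
    · exact Or.inr (Or.inl ⟨a, b, hPN δ c⟩)
    · exact Or.inr (Or.inr ⟨a, b, hPO δ c⟩)

/-! ### `swap12` (generator `I`): exchange the pencils `1` and `2` -/

/-- exchange the roles of the pencils `1` and `2`: orbit names `t ↦ φ t`, `φ ↦ φ⁻¹`, `g₁ ↔ g₂` -/
noncomputable def swap12 : TriangleData 11 where
  phi := invFun D.phi
  g1 := D.g2
  g2 := D.g1
  mem s t x := D.mem s (invFun D.phi t) x

/-- the new `φ` is the inverse of `φ` (right inverse) -/
theorem phi_swap12_phi (hinj : Injective D.phi) (t : Fin 11) : D.phi (D.swap12.phi t) = t :=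
  invFun_eq (Finite.surjective_of_injective hinj t)

/-- the new `φ` is the inverse of `φ` (left inverse) -/
theorem swap12_phi_phi (hinj : Injective D.phi) (t : Fin 11) : D.swap12.phi (D.phi t) = t :=
  leftInverse_invFun hinj t

/-- `swap12` keeps `φ 0 = 0` -/
theorem swap12_phi_zero (hinj : Injective D.phi) (h0 : D.phi 0 = 0) : D.swap12.phi 0 = 0 := by
  conv_lhs => rw [← h0]
  exact D.swap12_phi_phi hinj 0

/-- `swap12` preserves validity -/
theorem swap12_valid (h : D.Valid) : D.swap12.Valid := by
  obtain ⟨⟨hp1, hp2⟩, hK, hX⟩ := h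
  have hinj : Injective D.phi := fun a b e => hp1 a b e
  have hbij : Bijective (invFun D.phi) :=
    ⟨(rightInverse_invFun (Finite.surjective_of_injective hinj)).injective, (leftInverse_invFun hinj).surjective⟩
  let π : Fin 11 ≃ Fin 11 := Equiv.ofBijective _ hbij
  have hπ : ∀ u, π u = invFun D.phi u := fun u => rfl
  have hφπ : ∀ u, D.phi (π u) = u := fun u => D.phi_swap12_phi hinj u
  have hm : ∀ s u x, D.swap12.mem s u x = D.mem s (π u) x := fun s u x => rfl
  refine ⟨⟨fun t t' e => hbij.1 e, fun t t' e => ?_⟩, fun s => ?_, fun s s' hss' => ?_⟩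
  · have e' : t - π t = t' - π t' := e
    have key : ∀ u : Fin 11, π u - D.phi (π u) = -(u - π u) := fun u => by rw [hφπ]; ring
    have := hp2 (π t) (π t') (by rw [key, key, e'])
    exact π.injective this
  · obtain ⟨h0, h1, h2, hD⟩ := hK s
    refine ⟨?_, ?_, ?_, ?_⟩
    · exact partitionOK_transfer π id injective_id rfl (fun u y => by rw [hm]; rfl) h0
    · exact partitionOK_transfer π id injective_id rfl (fun u y => by rw [hm]; simp only [id, hφπ]) h2
    · exact partitionOK_transfer π id injective_id rfl (fun u y => by rw [hm]; rfl) h1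
    · exact internalOK_transfer π (fun _ => Equiv.refl _) id (fun δ hδ => hδ) (hm s) (fun u z δ => rfl) hD
  · obtain ⟨hg1, hg2, hp0, hδ⟩ := hX s s' hss'
    have hPN : ∀ δ, D.PairNone s s' δ → D.swap12.PairNone s s' δ := fun δ =>
      pairNone_transfer π (fun _ => Equiv.refl _) (hm s) (fun u x => hm s' u _)
    have hPO : ∀ δ, D.PairOne s s' δ → D.swap12.PairOne s s' δ := fun δ =>
      pairOne_transfer π (fun _ => Equiv.refl _) (hm s) (fun u x => hm s' u _)
    refine ⟨hg2, hg1, hPN 0 hp0, fun δ hδ0 => ?_⟩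
    show (D.g2 s - D.g2 s' = δ ∧ D.g1 s - D.g1 s' ≠ δ ∧ _) ∨ (D.g2 s - D.g2 s' ≠ δ ∧ D.g1 s - D.g1 s' = δ ∧ _) ∨
      (D.g2 s - D.g2 s' ≠ δ ∧ D.g1 s - D.g1 s' ≠ δ ∧ _)
    rcases hδ δ hδ0 with ⟨a, b, c⟩ | ⟨a, b, c⟩ | ⟨a, b, c⟩
    · exact Or.inr (Or.inl ⟨b, a, hPN δ c⟩)
    · exact Or.inl ⟨b, a, hPN δ c⟩
    · exact Or.inr (Or.inr ⟨b, a, hPO δ c⟩)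

/-! ### `swap01` (generator `S`): exchange the pencils `0` and `1` -/

/-- exchange the roles of the pencils `0` and `1`: orbit names `t ↦ −t`, free base points moved to the old first pencil, free base lines
re-chosen through the new `Q₀` -/
def swap01 : TriangleData 11 where
  phi t := D.phi (-t) + t
  g1 s := - D.g1 s
  g2 s := D.g2 s - D.g1 s
  mem s t x := D.mem s (-t) (x - t + D.g1 s)

/-- the new `φ` -/
theorem swap01_phi (t : Fin 11) : D.swap01.phi t = D.phi (-t) + t := rfl

/-- `swap01` keeps `φ 0 = 0` -/
theorem swap01_phi_zero (h0 : D.phi 0 = 0) : D.swap01.phi 0 = 0 := by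
  show D.phi (-0) + 0 = 0; rw [neg_zero, h0, add_zero]

/-- `swap01` preserves validity -/
theorem swap01_valid (h : D.Valid) : D.swap01.Valid := by
  obtain ⟨⟨hp1, hp2⟩, hK, hX⟩ := h
  let ν : Fin 11 ≃ Fin 11 := Equiv.neg (Fin 11)
  have hν : ∀ u, ν u = -u := fun u => rfl
  have hm : ∀ s u x, D.swap01.mem s u x = D.mem s (ν u) (addEquiv11 (D.g1 s - u) x) := fun s u x => by
    show D.mem s (-u) (x - u + D.g1 s) = D.mem s (-u) (x + (D.g1 s - u)); congr 1; ring
  refine ⟨⟨fun t t' e => ?_, fun t t' e => ?_⟩, fun s => ?_, fun s s' hss' => ?_⟩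
  · have e' : D.phi (-t) + t = D.phi (-t') + t' := e
    have key : ∀ u : Fin 11, -u - D.phi (-u) = -(D.phi (-u) + u) := fun u => by ring
    have := hp2 (-t) (-t') (by rw [key, key, e'])
    exact neg_injective this
  · have e' : t - (D.phi (-t) + t) = t' - (D.phi (-t') + t') := e
    have key : ∀ u : Fin 11, u - (D.phi (-u) + u) = -D.phi (-u) := fun u => by ring
    rw [key, key] at e'
    exact neg_injective (hp1 _ _ (neg_injective e'))
  · obtain ⟨h0, h1, h2, hD⟩ := hK s
    refine ⟨?_, ?_, ?_, ?_⟩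
    · refine partitionOK_transfer ν (fun y => y + D.g1 s) (add_left_injective _) (zero_add _) (fun u y => ?_) h1
      rw [hm]; simp only [hν, addEquiv11_apply, id]; congr 1; ring
    · refine partitionOK_transfer ν (fun y => y + D.g1 s) (add_left_injective _) ?_ (fun u y => ?_) h0
      · show -D.g1 s + D.g1 s = 0; ring
      · rw [hm]; simp only [hν, addEquiv11_apply, id]; congr 1; ring
    · refine partitionOK_transfer ν (fun y => y + D.g1 s) (add_left_injective _) ?_ (fun u y => ?_) h2
      · show D.g2 s - D.g1 s + D.g1 s = D.g2 s; ring
      · rw [hm]; simp only [hν, addEquiv11_apply]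
        show D.mem s (-u) (y + (D.phi (-u) + u) + (D.g1 s - u)) = _; congr 1; ring
    · exact internalOK_transfer ν (fun u => addEquiv11 (D.g1 s - u)) id (fun δ hδ => hδ) (hm s)
        (fun u z δ => by simp only [addEquiv11_apply, id]; ring) hD
  · obtain ⟨hg1, hg2, hp0, hδ⟩ := hX s s' hss'
    have hPN : ∀ δ, D.PairNone s s' (δ + (D.g1 s - D.g1 s')) → D.swap01.PairNone s s' δ := fun δ =>
      pairNone_transfer ν (fun u => addEquiv11 (D.g1 s - u)) (hm s) (fun u x => by
        show D.mem s' (-u) (x - δ - u + D.g1 s') = D.mem s' (-u) (x + (D.g1 s - u) - (δ + (D.g1 s - D.g1 s'))); congr 1; ring)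
    have hPO : ∀ δ, D.PairOne s s' (δ + (D.g1 s - D.g1 s')) → D.swap01.PairOne s s' δ := fun δ =>
      pairOne_transfer ν (fun u => addEquiv11 (D.g1 s - u)) (hm s) (fun u x => by
        show D.mem s' (-u) (x - δ - u + D.g1 s') = D.mem s' (-u) (x + (D.g1 s - u) - (δ + (D.g1 s - D.g1 s'))); congr 1; ring)
    have hΔ1 : D.g1 s - D.g1 s' ≠ 0 := fun e => hg1 (sub_eq_zero.1 e)
    -- the cross condition of `D` at `δ = Δ₁` forces its first alternative
    have hfirst : D.g2 s - D.g2 s' ≠ D.g1 s - D.g1 s' ∧ D.PairNone s s' (D.g1 s - D.g1 s') := by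
      rcases hδ _ hΔ1 with ⟨_, b, c⟩ | ⟨a, _, _⟩ | ⟨a, _, _⟩
      · exact ⟨b, c⟩
      · exact (a rfl).elim
      · exact (a rfl).elim
    refine ⟨fun e => hg1 (neg_injective (e : -D.g1 s = -D.g1 s')), fun e => hfirst.1 ?_, hPN 0 (by rw [zero_add]; exact hfirst.2),
      fun δ hδ0 => ?_⟩
    · have e' : D.g2 s - D.g1 s = D.g2 s' - D.g1 s' := e
      calc D.g2 s - D.g2 s' = (D.g2 s - D.g1 s) - (D.g2 s' - D.g1 s') + (D.g1 s - D.g1 s') := by ring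
        _ = D.g1 s - D.g1 s' := by rw [e', sub_self, zero_add]
    show (-D.g1 s - -D.g1 s' = δ ∧ D.g2 s - D.g1 s - (D.g2 s' - D.g1 s') ≠ δ ∧ _) ∨
      (-D.g1 s - -D.g1 s' ≠ δ ∧ D.g2 s - D.g1 s - (D.g2 s' - D.g1 s') = δ ∧ _) ∨
      (-D.g1 s - -D.g1 s' ≠ δ ∧ D.g2 s - D.g1 s - (D.g2 s' - D.g1 s') ≠ δ ∧ _)
    have r1 : -D.g1 s - -D.g1 s' = δ ↔ δ + (D.g1 s - D.g1 s') = 0 :=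
      ⟨fun e => by linear_combination -e, fun e => by linear_combination -e⟩
    have r2 : D.g2 s - D.g1 s - (D.g2 s' - D.g1 s') = δ ↔ D.g2 s - D.g2 s' = δ + (D.g1 s - D.g1 s') :=
      ⟨fun e => by linear_combination e, fun e => by linear_combination e⟩
    simp only [ne_eq, r1, r2]
    by_cases hz : δ + (D.g1 s - D.g1 s') = 0
    · refine Or.inl ⟨hz, fun e => hg2 (sub_eq_zero.1 (e.trans hz)), hPN δ (by rw [hz]; exact hp0)⟩
    · rcases hδ _ hz with ⟨a, _, _⟩ | ⟨_, b, c⟩ | ⟨_, b, c⟩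
      · exact (hδ0 (by linear_combination -a)).elim
      · exact Or.inr (Or.inl ⟨hz, b, hPN δ c⟩)
      · exact Or.inr (Or.inr ⟨hz, b, hPO δ c⟩)

end TriangleData

end Summit.Ventures.DiscreteObjects.PP12
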